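/-
Copyright: statement-level skeleton of a published paper (lit-balaban cell, Phase-2 proof seat p19, gen 4). No claims beyond
what the kernel checks below.
-/
import Mathlib
import Literature.MathematicalPhysics.QuantumFieldTheory.Balaban1983to89.B3Ineq213Points

/-!
# B3 — T. Bałaban, *(Higgs)₂,₃ quantum fields in a finite volume. III. Renormalization*, CMP **88** (1983) 411–445
[Balaban1983Higgs3] — Sect. 2, p. 425: the lattice calculus behind the integration by parts (2.8)/(2.9) (shifts,
difference quotients, summation by parts over the points of a localization cube, the Leibniz rule)

statement-level skeleton of published theorems with citation tags; proofs where landed; nothing here is a claim about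
the Yang–Mills mass gap

PDF held: `paper:balaban1983-higgs-2-3-quantum-fields-finite-volume` (journal page = PDF page + 410); display (2.8) read on
the ×2 render `pub-balaban/b2b-balaban-ref1/pages/1983-cmp88-higgs23-III/1983-cmp88-higgs23-III-p015-x2.png` (p. 425).

Part of the Phase-2 work on SKELETON rows **B3.Prop2.1 / B3.Prop2.2** (unit `lit-balaban-p19` gen 4, HOME
`run/shared/lean/pub/lit-balaban/`): the (2.4) EXCEPTION of Proposition 2.1 inside the amplitude model of `B3Ineq213Amplitude`
(files `B3LatticeIBP` → `B3AmpIBP` → `B3AmpIBPDegrees` → `B3Prop21Except24`).  The printed identity (2.8) itself (fields,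
covariant derivatives, the representation `U`) is r15/p20's `B3Eq28SummationByParts.eq28`; here is the part of it that acts on
the POSITIONS of the amplitude model: summation by parts on the η-lattice points of a unit cube.

WHAT IS REPRODUCED.  p. 425 [PDF 15], verbatim: *"Our next step is to transform the whole expression in such a way that these
graphs are replaced by graphs with positive degrees. It can be done, e.g. by integration by parts. For a vertex in (2.4) we have
−e(L^kε) Σ_{b⊂T_η} η^d[(D^η_B̃φ′)(b)·qφ′(b₋)]g(b₋)A′_b = −e(L^kε) Σ_{x∈T_η} η^d φ′(x)·q(D^{η*}_B̃ φ′gA′)(x) = … (2.8)"* — the first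
equality is SUMMATION BY PARTS on the lattice (the derivative is moved from the propagator leg to the remaining factors of the
vertex).  KERNEL-CHECKED HERE, on the positions `ℕ^d` (η-units) of `B3Ineq213Points`: the shifts `x ± e_μ` (`fsh`, `bsh`), the
coordinate description of the points of a cube (`mem_pts_iff_coord`), and **`sum_mul_fdiff_eq`**: for a function `P` vanishing on
the two `μ`-faces of the cube `□` (the model of the smooth localization `h`, *"h = 0 outside some neighborhood of □(v)"* p. 420,
taken supported inside the cube), `Σ_{x∈□} P(x)·[K(x+e_μ) − K(x)] = Σ_{x∈□} [P(x−e_μ) − P(x)]·K(x)` — no boundary terms; with the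
mesh factor, `Σ_{x∈□} P·(∂⁺_μK) = −Σ_{x∈□} (∂⁻_μP)·K` (`sum_mul_fdiffQ_eq`).  Also the Leibniz rule for `∂⁻_μ` of an ordered product
(`prod_sub_prod_shift`, from Mathlib's `Finset.prod_add_ordered`), which the second and third equalities of (2.8) use.
-/

open Finset

namespace Literature.MathematicalPhysics.QuantumFieldTheory.Balaban1983to89.B3Ineq213

open B3Ineq215

variable {d : ℕ}

/-! ## Shifts and difference quotients on `ℕ^d` -/

/-- Forward shift `x + e_μ`. [cite: Balaban1983Higgs3, (2.8) p.425] -/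
def fsh (μ : Fin d) (x : Fin d → ℕ) : Fin d → ℕ := Function.update x μ (x μ + 1)

/-- Backward shift `x − e_μ` (truncated at the boundary `x_μ = 0` of the position orthant, where it is never used).
[cite: Balaban1983Higgs3, (2.8) p.425] -/
def bsh (μ : Fin d) (x : Fin d → ℕ) : Fin d → ℕ := Function.update x μ (x μ - 1)

/-- `(x + e_μ)_μ = x_μ + 1`. [cite: Balaban1983Higgs3, (2.8) p.425] -/
@[simp] theorem fsh_apply_same (μ : Fin d) (x : Fin d → ℕ) : fsh μ x μ = x μ + 1 := by simp [fsh]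

/-- `(x + e_μ)_ν = x_ν` for `ν ≠ μ`. [cite: Balaban1983Higgs3, (2.8) p.425] -/
theorem fsh_apply_of_ne {μ ν : Fin d} (h : ν ≠ μ) (x : Fin d → ℕ) : fsh μ x ν = x ν := by simp [fsh, h]

/-- `(x − e_μ)_μ = x_μ − 1`. [cite: Balaban1983Higgs3, (2.8) p.425] -/
@[simp] theorem bsh_apply_same (μ : Fin d) (x : Fin d → ℕ) : bsh μ x μ = x μ - 1 := by simp [bsh]

/-- `(x − e_μ)_ν = x_ν` for `ν ≠ μ`. [cite: Balaban1983Higgs3, (2.8) p.425] -/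
theorem bsh_apply_of_ne {μ ν : Fin d} (h : ν ≠ μ) (x : Fin d → ℕ) : bsh μ x ν = x ν := by simp [bsh, h]

/-- `(x + e_μ) − e_μ = x`. [cite: Balaban1983Higgs3, (2.8) p.425] -/
@[simp] theorem bsh_fsh (μ : Fin d) (x : Fin d → ℕ) : bsh μ (fsh μ x) = x := by
  funext ν
  by_cases h : ν = μ
  · subst h; simp
  · rw [bsh_apply_of_ne h, fsh_apply_of_ne h]

/-- `(x − e_μ) + e_μ = x` away from the boundary of the orthant. [cite: Balaban1983Higgs3, (2.8) p.425] -/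
theorem fsh_bsh {μ : Fin d} {x : Fin d → ℕ} (h : 0 < x μ) : fsh μ (bsh μ x) = x := by
  funext ν
  by_cases hν : ν = μ
  · subst hν; simp; omega
  · rw [fsh_apply_of_ne hν, bsh_apply_of_ne hν]

/-- The forward shift is injective. [cite: Balaban1983Higgs3, (2.8) p.425] -/
theorem fsh_injective (μ : Fin d) : Function.Injective (fsh (d := d) μ) := fun x y h => by
  simpa using congrArg (bsh μ) h

/-- Forward difference quotient `∂⁺_μ f(x) = s·(f(x+e_μ) − f(x))` with `s = η⁻¹`. [cite: Balaban1983Higgs3, (2.8) p.425] -/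
def fdiffQ (s : ℝ) (μ : Fin d) (f : (Fin d → ℕ) → ℝ) (x : Fin d → ℕ) : ℝ := s * (f (fsh μ x) - f x)

/-- Backward difference quotient `∂⁻_μ f(x) = s·(f(x) − f(x−e_μ))` with `s = η⁻¹` (the adjoint derivative `∂^{η*}` of (2.8)
up to sign: `Σ f·∂⁺g = −Σ (∂⁻f)·g`). [cite: Balaban1983Higgs3, (2.8) p.425] -/
def bdiffQ (s : ℝ) (μ : Fin d) (f : (Fin d → ℕ) → ℝ) (x : Fin d → ℕ) : ℝ := s * (f x - f (bsh μ x))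

/-- Unfolding of `∂⁺_μ`. [cite: Balaban1983Higgs3, (2.8) p.425] -/
theorem fdiffQ_apply (s : ℝ) (μ : Fin d) (f : (Fin d → ℕ) → ℝ) (x : Fin d → ℕ) :
    fdiffQ s μ f x = s * (f (fsh μ x) - f x) := rfl

/-- Unfolding of `∂⁻_μ`. [cite: Balaban1983Higgs3, (2.8) p.425] -/
theorem bdiffQ_apply (s : ℝ) (μ : Fin d) (f : (Fin d → ℕ) → ℝ) (x : Fin d → ℕ) :
    bdiffQ s μ f x = s * (f x - f (bsh μ x)) := rfl

/-! ## The points of a cube in coordinates -/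

variable {L : ℕ}

/-- `x` is a point of the cube `A` iff `L^s z_ν ≤ x_ν < L^s (z_ν + 1)` for every `ν`. [cite: Balaban1983Higgs3, (2.14) p.426] -/
theorem mem_pts_iff_coord (hL : 0 < L) {A : Cube d} {x : Fin d → ℕ} :
    x ∈ pts L A ↔ ∀ ν, A.lo L ν ≤ x ν ∧ x ν < A.hi L ν := by
  rw [mem_pts_iff hL, Cube.mem_desc_iff hL]
  simp only [pt_s, pt_z, Nat.sub_zero, true_and, Cube.lo, Cube.hi]
  have hq : 0 < L ^ A.s := pow_pos hL _
  refine forall_congr' fun ν => ?_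
  constructor
  · intro h
    constructor
    · have := (Nat.le_div_iff_mul_le hq).1 h.ge
      linarith [mul_comm (A.z ν) (L ^ A.s)]
    · have := (Nat.div_lt_iff_lt_mul hq).1 (Nat.lt_succ_iff.2 h.le)
      linarith [mul_comm (A.z ν + 1) (L ^ A.s)]
  · rintro ⟨h1, h2⟩
    apply le_antisymm
    · exact Nat.lt_succ_iff.1 ((Nat.div_lt_iff_lt_mul hq).2 (by linarith [mul_comm (A.z ν + 1) (L ^ A.s)]))
    · exact (Nat.le_div_iff_mul_le hq).2 (by linarith [mul_comm (A.z ν) (L ^ A.s)])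

/-- A point of `A` shifted forward stays in `A` unless it sat on the upper `μ`-face. [cite: Balaban1983Higgs3, (2.8) p.425] -/
theorem fsh_mem_pts (hL : 0 < L) {A : Cube d} {x : Fin d → ℕ} (hx : x ∈ pts L A) (μ : Fin d) (h : x μ + 1 < A.hi L μ) :
    fsh μ x ∈ pts L A := by
  rw [mem_pts_iff_coord hL] at hx ⊢
  intro ν
  by_cases hν : ν = μ
  · subst hν; rw [fsh_apply_same]; exact ⟨(hx ν).1.trans (Nat.le_succ _), h⟩
  · rw [fsh_apply_of_ne hν]; exact hx ν

/-- A point of `A` shifted backward stays in `A` unless it sat on the lower `μ`-face. [cite: Balaban1983Higgs3, (2.8) p.425] -/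
theorem bsh_mem_pts (hL : 0 < L) {A : Cube d} {x : Fin d → ℕ} (hx : x ∈ pts L A) (μ : Fin d) (h : A.lo L μ < x μ) :
    bsh μ x ∈ pts L A := by
  rw [mem_pts_iff_coord hL] at hx ⊢
  intro ν
  by_cases hν : ν = μ
  · subst hν; rw [bsh_apply_same]; constructor <;> [omega; exact lt_of_le_of_lt (Nat.sub_le _ _) (hx ν).2]
  · rw [bsh_apply_of_ne hν]; exact hx ν

/-! ## Summation by parts over the points of a cube -/

/-- Vanishing on the two `μ`-faces of the cube `A` (and outside the slab between them): the model of a localization function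
supported inside the cube. [cite: Balaban1983Higgs3, (2.8) p.425] -/
def FaceVanishing (L : ℕ) (A : Cube d) (μ : Fin d) (P : (Fin d → ℕ) → ℝ) : Prop :=
  ∀ x : Fin d → ℕ, (x μ ≤ A.lo L μ ∨ A.hi L μ ≤ x μ + 1) → P x = 0

/-- **Summation by parts on the lattice points of a cube** (the first equality of (2.8), positions only): if `P` vanishes on the
`μ`-faces of `□`, then `Σ_{x∈□} P(x)·[K(x+e_μ) − K(x)] = Σ_{x∈□} [P(x−e_μ) − P(x)]·K(x)` — no boundary terms.
[cite: Balaban1983Higgs3, (2.8) p.425] -/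
theorem sum_mul_fdiff_eq (hL : 0 < L) {A : Cube d} {μ : Fin d} {P : (Fin d → ℕ) → ℝ} (hP : FaceVanishing L A μ P)
    (K : (Fin d → ℕ) → ℝ) :
    ∑ x ∈ pts L A, P x * (K (fsh μ x) - K x) = ∑ x ∈ pts L A, (P (bsh μ x) - P x) * K x := by
  classical
  have hsplit : ∑ x ∈ pts L A, P x * (K (fsh μ x) - K x)
      = ∑ x ∈ pts L A, P x * K (fsh μ x) - ∑ x ∈ pts L A, P x * K x := by
    rw [← sum_sub_distrib]; exact sum_congr rfl fun x _ => by ring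
  have hsplit' : ∑ x ∈ pts L A, (P (bsh μ x) - P x) * K x
      = ∑ x ∈ pts L A, P (bsh μ x) * K x - ∑ x ∈ pts L A, P x * K x := by
    rw [← sum_sub_distrib]; exact sum_congr rfl fun x _ => by ring
  rw [hsplit, hsplit']
  congr 1
  -- reindex the first sum by the forward shift
  have hre : ∑ x ∈ pts L A, P x * K (fsh μ x) = ∑ y ∈ (pts L A).image (fsh μ), P (bsh μ y) * K y := by
    rw [sum_image fun x _ y _ h => fsh_injective μ h]
    exact sum_congr rfl fun x _ => by rw [bsh_fsh]
  rw [hre]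
  -- both sums agree with the sum over the union: the extra terms vanish on the faces
  have ha : ∑ y ∈ (pts L A).image (fsh μ), P (bsh μ y) * K y
      = ∑ y ∈ pts L A ∪ (pts L A).image (fsh μ), P (bsh μ y) * K y := by
    refine sum_subset subset_union_right fun y hy hy' => ?_
    have hyA : y ∈ pts L A := by
      rcases mem_union.1 hy with h | h
      · exact h
      · exact absurd h hy'
    have hlo : y μ ≤ A.lo L μ := by
      by_contra hlt
      push Not at hlt
      have hb : bsh μ y ∈ pts L A := bsh_mem_pts hL hyA μ hlt
      have hpos : 0 < y μ := lt_of_le_of_lt (Nat.zero_le _) hlt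
      exact hy' (mem_image.2 ⟨bsh μ y, hb, fsh_bsh hpos⟩)
    have : P (bsh μ y) = 0 := hP _ (Or.inl ((bsh_apply_same μ y).symm ▸ (Nat.sub_le _ _).trans hlo))
    rw [this, zero_mul]
  have hb : ∑ y ∈ pts L A, P (bsh μ y) * K y = ∑ y ∈ pts L A ∪ (pts L A).image (fsh μ), P (bsh μ y) * K y := by
    refine sum_subset subset_union_left fun y hy hy' => ?_
    have hyI : y ∈ (pts L A).image (fsh μ) := by
      rcases mem_union.1 hy with h | h
      · exact absurd h hy'
      · exact h
    obtain ⟨x, hx, rfl⟩ := mem_image.1 hyI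
    have hhi : A.hi L μ ≤ x μ + 1 := by
      by_contra hlt
      push Not at hlt
      exact hy' (fsh_mem_pts hL hx μ hlt)
    rw [bsh_fsh, hP x (Or.inr hhi), zero_mul]
  rw [ha, hb]

/-- The same with the mesh factor `s = η⁻¹` and the sign moved: `Σ_{x∈□} P·(∂⁺_μK) = Σ_{x∈□} (−∂⁻_μP)·K`.
[cite: Balaban1983Higgs3, (2.8) p.425] -/
theorem sum_mul_fdiffQ_eq (hL : 0 < L) {A : Cube d} {μ : Fin d} {P : (Fin d → ℕ) → ℝ} (hP : FaceVanishing L A μ P)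
    (s : ℝ) (K : (Fin d → ℕ) → ℝ) :
    ∑ x ∈ pts L A, P x * fdiffQ s μ K x = ∑ x ∈ pts L A, (-bdiffQ s μ P x) * K x := by
  simp only [fdiffQ, bdiffQ]
  calc ∑ x ∈ pts L A, P x * (s * (K (fsh μ x) - K x))
      = s * ∑ x ∈ pts L A, P x * (K (fsh μ x) - K x) := by
        rw [mul_sum]; exact sum_congr rfl fun x _ => by ring
    _ = s * ∑ x ∈ pts L A, (P (bsh μ x) - P x) * K x := by rw [sum_mul_fdiff_eq hL hP K]
    _ = ∑ x ∈ pts L A, -(s * (P x - P (bsh μ x))) * K x := by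
        rw [mul_sum]; exact sum_congr rfl fun x _ => by ring

/-- A product with one face-vanishing factor is face-vanishing. [cite: Balaban1983Higgs3, (2.8) p.425] -/
theorem FaceVanishing.mul_right {A : Cube d} {μ : Fin d} {P : (Fin d → ℕ) → ℝ} (hP : FaceVanishing L A μ P)
    (Q : (Fin d → ℕ) → ℝ) : FaceVanishing L A μ (fun x => P x * Q x) :=
  fun x hx => by simp [hP x hx]

/-- A product with one face-vanishing factor is face-vanishing. [cite: Balaban1983Higgs3, (2.8) p.425] -/
theorem FaceVanishing.mul_left {A : Cube d} {μ : Fin d} {P : (Fin d → ℕ) → ℝ} (hP : FaceVanishing L A μ P)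
    (Q : (Fin d → ℕ) → ℝ) : FaceVanishing L A μ (fun x => Q x * P x) :=
  fun x hx => by simp [hP x hx]

/-! ## The Leibniz rule for the backward difference of an ordered product -/

/-- Telescoping of a difference of products over a linearly ordered index set: `Π_i a_i − Π_i b_i = Σ_p (Π_{j<p} a_j)(a_p −
b_p)(Π_{j>p} b_j)` — with `a_i = g_i(x)`, `b_i = g_i(x − e_μ)` this is the Leibniz rule `∂⁻_μ(Π_i g_i)` used in the second and third
equalities of (2.8) (one term per factor; the factors after the differentiated one are shifted). From Mathlib's
`Finset.prod_add_ordered`. [cite: Balaban1983Higgs3, (2.8) p.425] -/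
theorem prod_sub_prod_ordered {ι R : Type*} [LinearOrder ι] [CommRing R] (T : Finset ι) (a b : ι → R) :
    ∏ i ∈ T, a i - ∏ i ∈ T, b i
      = ∑ p ∈ T, (∏ j ∈ T with j < p, a j) * (a p - b p) * ∏ j ∈ T with p < j, b j := by
  have h := Finset.prod_add_ordered T b (fun i => a i - b i)
  simp only [add_sub_cancel] at h
  rw [h, add_sub_cancel_left]
  exact sum_congr rfl fun p _ => by ring

/-- The Leibniz rule for `∂⁻_μ` of a product of lattice functions indexed by a linearly ordered finite set.
[cite: Balaban1983Higgs3, (2.8) p.425] -/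
theorem bdiffQ_prod {ι : Type*} [LinearOrder ι] (T : Finset ι) (s : ℝ) (μ : Fin d) (g : ι → (Fin d → ℕ) → ℝ)
    (x : Fin d → ℕ) :
    bdiffQ s μ (fun y => ∏ i ∈ T, g i y) x
      = ∑ p ∈ T, (∏ j ∈ T with j < p, g j x) * bdiffQ s μ (g p) x * ∏ j ∈ T with p < j, g j (bsh μ x) := by
  simp only [bdiffQ]
  rw [prod_sub_prod_ordered T (fun i => g i x) (fun i => g i (bsh μ x)), mul_sum]
  exact sum_congr rfl fun p _ => by ring

end Literature.MathematicalPhysics.QuantumFieldTheory.Balaban1983to89.B3Ineq213
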